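import Literature.MathematicalPhysics.QuantumLattice.KohnLuttingerFermiCurvePolarIntegral
import Literature.MathematicalPhysics.QuantumLattice.KohnLuttingerLindhardMeasurable
import HarnessLib

/-!
# The Kohn–Luttinger pairing form in polar coordinates

Topic `Literature/MathematicalPhysics/QuantumLattice`; continues `KohnLuttingerFermiCurvePolarIntegral`.
For `ε = squareDispersion 1 0`, `-4 < μ < 0`, `γ = fermiPolar μ`, `w = fermiPolarDOS μ`,
`Γ = kohnLuttingerKernel ε μ U`, and a gap function `ψ` that is a.e.-strongly measurable for the
Fermi-curve measure `μ_F`: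

* `integral_sq_fermiCurveMeasure` — `∫ ψ² dμ_F = ∫_{(-π,π]} w(θ) ψ(γθ)² dθ`;
* `integral_kernel_mul_eq_polar` — `∫ Γ(k,k') ψ(k') dμ_F(k') = ∫_{(-π,π]} w(θ') Γ(k, γθ') ψ(γθ') dθ'`;
* `stronglyMeasurable_kernelIntegral` — `k ↦ ∫ Γ(k,k') ψ(k') dμ_F(k')` is strongly measurable;
* `pairingForm_eq_polar` — **the pairing form as an iterated `dθ`-integral with the kernel**
  `M(θ, θ') = w(θ) Γ(γθ, γθ') w(θ')`:
  `pairingForm ε μ U ψ = ∫ Ψ(θ) (∫ M(θ,θ') Ψ(θ') dθ') dθ`, `Ψ = ψ ∘ γ`;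
* `pairingForm_const_mul` (`⟨cψ, Γ cψ⟩ = c² ⟨ψ, Γψ⟩`, unconditionally), `inChannel_const_mul`,
  `isChannelState_normalize` — normalising an in-channel `L²` function of positive norm gives a
  channel state.

Everything is proved; no definitions. [folklore]
-/

noncomputable section

open Real Set Filter MeasureTheory MeasureTheory.Measure
open scoped Topology ENNReal NNReal BigOperators

namespace Literature.MathematicalPhysics.QuantumLattice

/-! ### Scaling of gap functions (any dispersion) -/

/-- **The pairing form is `2`-homogeneous**: `⟨cψ, Γ(cψ)⟩ = c² ⟨ψ, Γψ⟩` (Bochner integrals are linear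
unconditionally). [folklore] -/
theorem pairingForm_const_mul (ε : Momentum → ℝ) (μ U c : ℝ) (ψ : Momentum → ℝ) :
    pairingForm ε μ U (fun k => c * ψ k) = c ^ 2 * pairingForm ε μ U ψ := by
  unfold pairingForm
  have hinner : ∀ k, ∫ k', kohnLuttingerKernel ε μ U k k' * (c * ψ k') ∂fermiCurveMeasure ε μ =
      c * ∫ k', kohnLuttingerKernel ε μ U k k' * ψ k' ∂fermiCurveMeasure ε μ := by
    intro k
    rw [← integral_const_mul]
    congr 1; funext k'; ring
  simp_rw [hinner]
  rw [← integral_const_mul]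
  congr 1; funext k; ring

/-- The isotypic projection is linear: `P_χ(cψ) = c P_χ ψ`. [folklore] -/
theorem d4Project_const_mul (χ : D4Irrep) (c : ℝ) (ψ : Momentum → ℝ) :
    d4Project χ (fun k => c * ψ k) = fun k => c * d4Project χ ψ k := by
  funext k
  simp only [d4Project, Finset.mul_sum]
  refine Finset.sum_congr rfl fun g _ => ?_
  ring

/-- Scalar multiples stay in the channel. [folklore] -/
theorem inChannel_const_mul {χ : D4Irrep} (c : ℝ) {ψ : Momentum → ℝ} (h : InChannel χ ψ) :
    InChannel χ (fun k => c * ψ k) := by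
  unfold InChannel at h ⊢
  rw [d4Project_const_mul, h]

/-- **Normalisation**: an in-channel `L²(μ_F)` gap function of positive norm, divided by its norm, is a
channel state. [folklore] -/
theorem isChannelState_normalize {ε : Momentum → ℝ} {μ : ℝ} {χ : D4Irrep} {ψ : Momentum → ℝ}
    (hmem : MemLp ψ 2 (fermiCurveMeasure ε μ)) (hch : InChannel χ ψ)
    (hpos : 0 < ∫ k, ψ k ^ 2 ∂fermiCurveMeasure ε μ) :
    IsChannelState ε μ χ (fun k => (Real.sqrt (∫ k, ψ k ^ 2 ∂fermiCurveMeasure ε μ))⁻¹ * ψ k) := by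
  set N := ∫ k, ψ k ^ 2 ∂fermiCurveMeasure ε μ with hN
  have hsq : Real.sqrt N ≠ 0 := (Real.sqrt_pos.2 hpos).ne'
  refine ⟨hmem.const_mul _, ?_, inChannel_const_mul _ hch⟩
  have : (fun k => ((Real.sqrt N)⁻¹ * ψ k) ^ 2) = fun k => (Real.sqrt N)⁻¹ ^ 2 * ψ k ^ 2 := by
    funext k; ring
  rw [this, integral_const_mul, ← hN, inv_pow, Real.sq_sqrt hpos.le, inv_mul_cancel₀ hpos.ne']

/-! ### The pairing form of the square lattice in polar coordinates -/

section Polar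

variable {μ : ℝ} (hμ₁ : -4 < μ) (hμ₂ : μ < 0)
include hμ₁ hμ₂

/-- **`∫ ψ² dμ_F = ∫_{(-π,π]} w(θ) ψ(γθ)² dθ`.** [folklore] -/
theorem integral_sq_fermiCurveMeasure {ψ : Momentum → ℝ}
    (hψ : AEStronglyMeasurable ψ (fermiCurveMeasure (squareDispersion 1 0) μ)) :
    ∫ k, ψ k ^ 2 ∂fermiCurveMeasure (squareDispersion 1 0) μ =
      ∫ θ in Ioc (-π) π, fermiPolarDOS μ θ * ψ (fermiPolar μ θ) ^ 2 :=
  integral_fermiCurveMeasure hμ₁ hμ₂ (hψ.pow 2)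

omit hμ₁ hμ₂ in
/-- The kernel slice `k' ↦ Γ(k, k') ψ(k')` is a.e.-strongly measurable for `μ_F`. [folklore] -/
theorem aestronglyMeasurable_kernel_mul (U : ℝ) {ψ : Momentum → ℝ}
    (hψ : AEStronglyMeasurable ψ (fermiCurveMeasure (squareDispersion 1 0) μ)) (k : Momentum) :
    AEStronglyMeasurable (fun k' => kohnLuttingerKernel (squareDispersion 1 0) μ U k k' * ψ k')
      (fermiCurveMeasure (squareDispersion 1 0) μ) :=
  (measurable_kohnLuttingerKernel_right (by unfold squareDispersion; fun_prop : Measurable (squareDispersion 1 0)) μ U k).aestronglyMeasurable.mul hψ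

/-- **`∫ Γ(k,k') ψ(k') dμ_F(k') = ∫_{(-π,π]} w(θ') Γ(k, γθ') ψ(γθ') dθ'`.** [folklore] -/
theorem integral_kernel_mul_eq_polar (U : ℝ) {ψ : Momentum → ℝ}
    (hψ : AEStronglyMeasurable ψ (fermiCurveMeasure (squareDispersion 1 0) μ)) (k : Momentum) :
    ∫ k', kohnLuttingerKernel (squareDispersion 1 0) μ U k k' * ψ k' ∂fermiCurveMeasure (squareDispersion 1 0) μ =
      ∫ θ' in Ioc (-π) π, fermiPolarDOS μ θ' *
        (kohnLuttingerKernel (squareDispersion 1 0) μ U k (fermiPolar μ θ') * ψ (fermiPolar μ θ')) :=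
  integral_fermiCurveMeasure hμ₁ hμ₂ (aestronglyMeasurable_kernel_mul U hψ k)

/-- **`k ↦ ∫ Γ(k,k') ψ(k') dμ_F(k')` is strongly measurable** (replace `ψ` by a measurable
modification; Fubini measurability for the finite measure `μ_F`). [folklore] -/
theorem stronglyMeasurable_kernelIntegral (U : ℝ) {ψ : Momentum → ℝ}
    (hψ : AEStronglyMeasurable ψ (fermiCurveMeasure (squareDispersion 1 0) μ)) :
    StronglyMeasurable fun k => ∫ k', kohnLuttingerKernel (squareDispersion 1 0) μ U k k' * ψ k'
      ∂fermiCurveMeasure (squareDispersion 1 0) μ := by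
  haveI := isFiniteMeasure_fermiCurveMeasure hμ₁ hμ₂
  set ν := fermiCurveMeasure (squareDispersion 1 0) μ with hν
  -- a strongly measurable modification of `ψ`
  have heq : ∀ k, ∫ k', kohnLuttingerKernel (squareDispersion 1 0) μ U k k' * ψ k' ∂ν =
      ∫ k', kohnLuttingerKernel (squareDispersion 1 0) μ U k k' * hψ.mk ψ k' ∂ν := fun k =>
    integral_congr_ae (by filter_upwards [hψ.ae_eq_mk] with k' hk'; rw [hk'])
  have hunc : StronglyMeasurable (Function.uncurry fun k k' : Momentum =>
      kohnLuttingerKernel (squareDispersion 1 0) μ U k k' * hψ.mk ψ k') :=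
    ((measurable_kohnLuttingerKernel_uncurry (by unfold squareDispersion; fun_prop : Measurable (squareDispersion 1 0)) μ U).mul
      (hψ.stronglyMeasurable_mk.measurable.comp measurable_snd)).stronglyMeasurable
  have h := StronglyMeasurable.integral_prod_right (ν := ν) hunc
  have hfun : (fun k => ∫ k', kohnLuttingerKernel (squareDispersion 1 0) μ U k k' * ψ k' ∂ν) =
      fun k => ∫ k', kohnLuttingerKernel (squareDispersion 1 0) μ U k k' * hψ.mk ψ k' ∂ν := funext heq
  rw [hfun]
  exact h

/-- The integrand of the outer integral of the pairing form is a.e.-strongly measurable. [folklore] -/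
theorem aestronglyMeasurable_mul_kernelIntegral (U : ℝ) {ψ : Momentum → ℝ}
    (hψ : AEStronglyMeasurable ψ (fermiCurveMeasure (squareDispersion 1 0) μ)) :
    AEStronglyMeasurable (fun k => ψ k * ∫ k', kohnLuttingerKernel (squareDispersion 1 0) μ U k k' * ψ k'
      ∂fermiCurveMeasure (squareDispersion 1 0) μ) (fermiCurveMeasure (squareDispersion 1 0) μ) :=
  hψ.mul (stronglyMeasurable_kernelIntegral hμ₁ hμ₂ U hψ).aestronglyMeasurable

/-- **The pairing form in polar coordinates**: with `Ψ = ψ ∘ γ` and the kernel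
`M(θ, θ') = w(θ) Γ(γθ, γθ') w(θ')`,
`⟨ψ, Γψ⟩_{μ_F} = ∫_{(-π,π]} Ψ(θ) (∫_{(-π,π]} M(θ, θ') Ψ(θ') dθ') dθ` for every `ψ` that is
a.e.-strongly measurable for `μ_F`. [folklore] -/
theorem pairingForm_eq_polar (U : ℝ) {ψ : Momentum → ℝ}
    (hψ : AEStronglyMeasurable ψ (fermiCurveMeasure (squareDispersion 1 0) μ)) :
    pairingForm (squareDispersion 1 0) μ U ψ =
      ∫ θ in Ioc (-π) π, ψ (fermiPolar μ θ) * ∫ θ' in Ioc (-π) π,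
        (fermiPolarDOS μ θ * kohnLuttingerKernel (squareDispersion 1 0) μ U (fermiPolar μ θ) (fermiPolar μ θ') *
          fermiPolarDOS μ θ') * ψ (fermiPolar μ θ') := by
  unfold pairingForm
  rw [integral_fermiCurveMeasure hμ₁ hμ₂ (aestronglyMeasurable_mul_kernelIntegral hμ₁ hμ₂ U hψ)]
  refine setIntegral_congr_fun measurableSet_Ioc fun θ _ => ?_
  rw [integral_kernel_mul_eq_polar hμ₁ hμ₂ U hψ, ← mul_assoc, mul_comm (fermiPolarDOS μ θ) (ψ (fermiPolar μ θ)),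
    mul_assoc, ← integral_const_mul]
  congr 1
  refine setIntegral_congr_fun measurableSet_Ioc fun θ' _ => ?_
  ring

/-- The same with `w` kept outside: `⟨ψ, Γψ⟩ = ∫ w Ψ (∫ w' Γ(γθ,γθ') Ψ' dθ') dθ`. [folklore] -/
theorem pairingForm_eq_polar' (U : ℝ) {ψ : Momentum → ℝ}
    (hψ : AEStronglyMeasurable ψ (fermiCurveMeasure (squareDispersion 1 0) μ)) :
    pairingForm (squareDispersion 1 0) μ U ψ =
      ∫ θ in Ioc (-π) π, fermiPolarDOS μ θ * (ψ (fermiPolar μ θ) * ∫ θ' in Ioc (-π) π,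
        fermiPolarDOS μ θ' * (kohnLuttingerKernel (squareDispersion 1 0) μ U (fermiPolar μ θ) (fermiPolar μ θ') *
          ψ (fermiPolar μ θ'))) := by
  unfold pairingForm
  rw [integral_fermiCurveMeasure hμ₁ hμ₂ (aestronglyMeasurable_mul_kernelIntegral hμ₁ hμ₂ U hψ)]
  refine setIntegral_congr_fun measurableSet_Ioc fun θ _ => ?_
  rw [integral_kernel_mul_eq_polar hμ₁ hμ₂ U hψ]

end Polar

end Literature.MathematicalPhysics.QuantumLattice

end
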